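import Summits.BirchSwinnertonDyer.Rank1Residual.X11a.PrintDischargeEulerHalf
import Literature.NumberTheory.EllipticCurves.MatarNekovar2019.ShaVanishing
import HarnessLib

/-!
# Class X11a — the PRINT route's discharge interface, part 5: the FIELD CLAUSES of the Heegner
# doors are automatic on the leaf (`hpD`-free Cha doors; the Matar–Nekovář 2019 Thm. 6.7 (1)
# unit door with NO `d_K`-clause) — cell `bsd-print-x11a`, seat ty2; D-0131 (2)

PARTITION CURRENCY (D-0054 (2) / D-0131 (2)): leaf `ClassX11a W p` (`r_an = 0`, `p` odd, `p ‖ N`,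
`E[p]` irreducible, no (ram) prime). THEOREMS ONLY: no definition, no named fact, nothing asserted;
every published input is an explicit named-fact hypothesis already in the tree (`hCha` Cha 2005
Thm. 21 print-exact `Cha2005.thm52_padicValNat_shaOrder_le_discr`, `hMN` Matar–Nekovář 2019
Thm. 6.7 (1) `MatarNekovar2019.thm67_sha_primary_trivial_of_irreducible`, `hC` Carayol
`IsNewformOf.level_eq_conductorNorm`, `hGZK`). Parts 1–4 (`PrintDischarge`, `…Fouquet`,
`…Transport`, `…EulerHalf`) are imported, not restated.

WHAT THIS FILE IS. Part 4 §3 (d) gave the Heegner-index doors to crux 20406's currency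
`Typed.MissingUpperBoundAt W p` and to `BSDp W p` on the NON-surjective sub-leaf with Cha's field
clauses `p ∤ d_K` (`hpD`), `d_K ∉ {−3, −4}` (`hD3 hD4`) and the level clause `p² ∤ N` (`hpN`, or
Carayol `hC`) displayed. On X11a the prime `p` divides the conductor (`p ‖ N_E`, class atom `.mult`);
the level `N` of a Heegner datum `IsHeegnerPoint N W K P` IS the conductor granted Carayol's theorem
(`hC`, tree `X11b.level_eq_conductorNorm_of_isHeegnerPoint`) — otherwise `p ∣ N` is one displayed,
decidable numeral fact of the record. The Heegner hypothesis for `N` then says `p` SPLITS in `K`, so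
`p` is unramified: `p ∤ d_K` (tree `Literature.SatisfiesHeegnerHypothesis.not_dvd_discr`, the
decomposition law in quadratic fields). This discharges Cha's binder `hpD` ("`p ∤ D_K`", Cha 2005
Assumption 1 / Thm. 21; Cha's own proof opens "the prime `ℓ` is unramified in `K/ℚ`", p. 173) and,
at `p = 3`, Matar–Nekovář's exclusion `(K, p) ≠ (ℚ(√−3), 3)` (`3 ∣ −3`). Hence:
* §1 the two field clauses from `p ∣ N` (class-free), and `p ∣ N` / `p ∤ d_K` on the class granted
  Carayol;
* §2 (d′′) Cha's bound and doors WITHOUT `hpD`: primed forms of part 4's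
  `cha_padicValNat_shaOrder_le`, `missingUpperBoundAt_of_cha_of_index_le[_of_carayol]`,
  `bsdp_of_chaCertificate[_of_carayol]` — the record displays only `K` (`hK hH hD3 hD4`), `y_K`
  (`hP hnt hI`), `#Ш_an` (`hq hv`) and, without Carayol, the numerals `p ∣ N`, `p² ∤ N`;
* §3 (f) the Matar–Nekovář 2019 Thm. 6.7 (1) UNIT door (`hMN`; `E[p]` irreducible only — no
  surjectivity, no `d_K`-clause at all, any reduction at `p`; PUBLISHED, JTNB 31): `p ∤ [E(K) : ℤ y_K]`
  ⇒ `Ш(E/ℚ)[p] = 0` ⇒ the Euler half at `0 ≤ ord_p #Ш_an`, and `BSD(E,p)` (both halves) at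
  `ord_p #Ш_an = 0` — binders: facts `hMN hGZK [hC]` · class `hX` · field `hK hH` · point `hP hnt hI`
  · [`p ∣ N`] · `hq hv`. The cleanest printed door for the UNIT non-surjective cells of crux 20406
  (the 3Ns/3Nn cells of the N7 residue at `p = 3`; the 16 non-split 5S4 candidates of the planner's
  Heegner-index kit job at `p = 5`);
* §4 Cha's corner `d_K ∈ {−3, −4}` is EMPTY at `p = 3` and at even level (`2` split ⟺
  `d_K ≡ 1 (mod 8)`; `3` split excludes `−3` (ramified) and `−4` (inert); `5` split excludes `−3`):
  at `p = 3` — the 3Ns/3Nn regime of crux 20406 — Cha's doors display NO field or level clause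
  granted Carayol (`…_of_carayol_three`); at even level feed `discr_ne_of_two_dvd_level` to §2.
Cell reading: `pub/bsd-print-x11a/DOSSIER.md` §13 (lit g2 findings F1, F5).

| door on X11a (this file) | image hyp | displayed per pair | facts |
|---|---|---|---|
| `ClassX11a.missingUpperBoundAt_of_cha_of_index_le'` | none | `K` (`hK hH hD3 hD4`), `y_K` (`hP hnt`), `ord_p` index `≤ k`, `p² ∤ N`, `p ∣ N`, `2k ≤ ord_p q` | `hCha` |
| `ClassX11a.missingUpperBoundAt_of_cha_of_index_le_of_carayol'` | none | `K` (`hK hH hD3 hD4`), `y_K`, `ord_p` index `≤ k`, `2k ≤ ord_p q` | `hCha hC` |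
| `ClassX11a.bsdp_of_chaCertificate'` / `…_of_carayol'` | none | same with `p ∤` index, `ord_p q = 0` | `hCha hGZK [hC]` |
| `ClassX11a.missingUpperBoundAt_of_matarNekovar_of_not_dvd_index[_of_carayol]` | none | `K` (`hK hH`), `y_K` (`hP hnt`), `p ∤` index, [`p ∣ N`], `0 ≤ ord_p q` | `hMN hGZK [hC]` |
| `ClassX11a.bsdp_of_matarNekovarCertificate[_of_carayol]`, `.halves_of_matarNekovarCertificate` | none | same with `ord_p q = 0` | `hMN hGZK [hC]` |
| `ClassX11a.missingUpperBoundAt_of_cha_of_index_le_of_carayol_three`, `.bsdp_of_chaCertificate_of_carayol_three` | none | `K` (`hK hH`), `y_K`, index bound, `#Ш_an`; `p = 3` | `hCha [hGZK] hC` |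

References: [Cha2005] Assumption 1 (p. 155), Thm. 21 (p. 173), §5.1; [MatarNekovar2019] Thm. 6.7 (1)
(p. 498) = Thm. 0.12 (1) (p. 457), §6.1 (p. 497); [Miller2011LMS] Def. 1.1, Thm. 5.2;
[GrigorovJorzaPatrikisSteinTarnita2009] Thm. 3.5, Prop. 3.1; [Carayol1986] Thm. (A);
[SilvermanATAEC1994] IV.10.2; [Darmon2004] Hypothesis 3.9; [Marcus2018] Ch. 3 Thm. 25;
[SerreGaloisCohomology1997] I.§2.4; cell files `pub/bsd-print-x11a/TY2-DISCHARGE-INTERFACE.md` §H–§I,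
`DOSSIER.md` §13.
-/

set_option autoImplicit false

noncomputable section

open scoped Classical

open WeierstrassCurve Literature.NumberTheory.EllipticCurves
  Literature.NumberTheory.EllipticCurves.ModularForms
  Literature.NumberTheory.EllipticCurves.Rank1Residual
  Literature.NumberTheory.EllipticCurves.Rank1Residual.Typed
  Literature.NumberTheory.EllipticCurves.Cha2005

namespace Summit.BirchSwinnertonDyer.Rank1Residual.X11a

variable {W : WeierstrassCurve ℚ} [W.IsElliptic] [W.IsGloballyMinimal] {p : ℕ} [Fact p.Prime]
  {N : ℕ} [NeZero N] {K : Type} [Field K] [NumberField K]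

/-! ### §1 The field clauses from `p ∣ N`; `p ∣ N` and `p ∤ d_K` on the class granted Carayol -/

omit [NeZero N] in
/-- **Heegner hypothesis + `p ∣ N` ⟹ `p ∤ d_K`** (`K` quadratic): a prime dividing the level splits
in `K`, hence is unramified (decomposition law; tree `Literature.SatisfiesHeegnerHypothesis.not_dvd_discr`).
Class-free; the class supplies `p ∣ N` below. [cite: Darmon2004, Hypothesis 3.9 (p. 35)]
[cite: Marcus2018, Ch. 3 Thm. 25] -/
theorem not_dvd_discr_of_dvd_level (hK : IsImaginaryQuadratic K)
    (hH : SatisfiesHeegnerHypothesis N K) (hpN : p ∣ N) : ¬ (p : ℤ) ∣ NumberField.discr K :=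
  Literature.SatisfiesHeegnerHypothesis.not_dvd_discr hK.1 hH Fact.out hpN

omit [NeZero N] in
/-- **Heegner hypothesis + `p ∣ N` ⟹ `(K, p) ≠ (ℚ(√−3), 3)`** in the tree's spelling
"`p = 3 → d_K ≠ −3`" (the exclusion of Matar–Nekovář 2019 Thm. 6.7 (1)): `3 ∣ N` makes `3`
unramified in `K`, while `3 ∣ d_{ℚ(√−3)} = −3`. [cite: MatarNekovar2019, Thm. 6.7 (1) (p. 498)]
[cite: Marcus2018, Ch. 3 Thm. 25] -/
theorem discr_ne_neg_three_of_dvd_level (hK : IsImaginaryQuadratic K)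
    (hH : SatisfiesHeegnerHypothesis N K) (hpN : p ∣ N) (hp3 : p = 3) :
    NumberField.discr K ≠ -3 := by
  intro hD
  refine not_dvd_discr_of_dvd_level hK hH hpN ?_
  rw [hD, hp3]
  norm_num

/-- **`p ∣ N` for the level of ANY Heegner datum of an X11a pair, granted Carayol** (`hC`: the level
of the newform inside the parametrisation datum is `N_E`; `p` multiplicative ⇒ `p ∣ N_E`, tree
`dvd_conductorNorm_iff_not_hasGoodReductionAtPrime`). [cite: Carayol1986, Thm. (A)]
[cite: SilvermanATAEC1994, IV.10.2 (b)] -/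
theorem _root_.Summit.BirchSwinnertonDyer.Rank1Residual.ClassX11a.dvd_level_of_isHeegnerPoint
    (hC : ∀ (M : ℕ) [NeZero M], IsNewformOf.level_eq_conductorNorm (N := M)) (hX : ClassX11a W p)
    {P : (W.baseChange K).toAffine.Point} (hP : IsHeegnerPoint N W K P) : p ∣ N := by
  rw [X11b.level_eq_conductorNorm_of_isHeegnerPoint W hC hP]
  exact (W.dvd_conductorNorm_iff_not_hasGoodReductionAtPrime p).mpr hX.not_good

/-- **`p ∤ d_K` for ANY Heegner field of an X11a pair, granted Carayol** — Cha's binder `hpD`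
DISCHARGED on the class (`p ∣ N = N_E` splits in `K`). [cite: Cha2005, Assumption 1 (p. 155) and Thm. 21 (p. 173)]
[cite: Carayol1986, Thm. (A)] [cite: Darmon2004, Hypothesis 3.9 (p. 35)] -/
theorem _root_.Summit.BirchSwinnertonDyer.Rank1Residual.ClassX11a.not_dvd_discr_of_isHeegnerPoint
    (hC : ∀ (M : ℕ) [NeZero M], IsNewformOf.level_eq_conductorNorm (N := M)) (hX : ClassX11a W p)
    (hK : IsImaginaryQuadratic K) (hH : SatisfiesHeegnerHypothesis N K)
    {P : (W.baseChange K).toAffine.Point} (hP : IsHeegnerPoint N W K P) :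
    ¬ (p : ℤ) ∣ NumberField.discr K :=
  not_dvd_discr_of_dvd_level hK hH (hX.dvd_level_of_isHeegnerPoint hC hP)

/-! ### §2 (d′′) Cha's bound and doors without `hpD` -/

/-- **Cha's bound at an X11a pair, `hpD`-free**: as `cha_padicValNat_shaOrder_le` with `p ∤ d_K`
replaced by the displayed `p ∣ N` (automatic split prime). [cite: Cha2005, Thm. 21 (p. 173) and §5.1]
[cite: Miller2011LMS, Thm. 5.2 (arXiv:1010.2431 p. 11)] -/
theorem _root_.Summit.BirchSwinnertonDyer.Rank1Residual.ClassX11a.cha_padicValNat_shaOrder_le'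
    (hCha : thm52_padicValNat_shaOrder_le_discr) (hX : ClassX11a W p)
    (hK : IsImaginaryQuadratic K) (hH : SatisfiesHeegnerHypothesis N K)
    {P : (W.baseChange K).toAffine.Point} (hP : IsHeegnerPoint N W K P) (hnt : ¬ IsOfFinAddOrder P)
    (hD3 : NumberField.discr K ≠ -3) (hD4 : NumberField.discr K ≠ -4)
    (hpN : ¬ p ^ 2 ∣ N) (hpN₁ : p ∣ N) :
    padicValNat p W.shaOrder ≤ 2 * padicValNat p (AddSubgroup.zmultiples P).index :=
  hX.cha_padicValNat_shaOrder_le hCha hK hH hP hnt (not_dvd_discr_of_dvd_level hK hH hpN₁) hD3 hD4 hpN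

/-- **Cha's bound at an X11a pair, granted Carayol: BOTH level clauses discharged** (`p ∤ d_K` and
`p² ∤ N`); the record displays only `K` (`hK hH hD3 hD4`) and `y_K` (`hP hnt`).
[cite: Cha2005, Thm. 21 (p. 173) and §5.1] [cite: Carayol1986, Thm. (A)] -/
theorem _root_.Summit.BirchSwinnertonDyer.Rank1Residual.ClassX11a.cha_padicValNat_shaOrder_le_of_carayol
    (hCha : thm52_padicValNat_shaOrder_le_discr)
    (hC : ∀ (M : ℕ) [NeZero M], IsNewformOf.level_eq_conductorNorm (N := M)) (hX : ClassX11a W p)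
    (hK : IsImaginaryQuadratic K) (hH : SatisfiesHeegnerHypothesis N K)
    {P : (W.baseChange K).toAffine.Point} (hP : IsHeegnerPoint N W K P) (hnt : ¬ IsOfFinAddOrder P)
    (hD3 : NumberField.discr K ≠ -3) (hD4 : NumberField.discr K ≠ -4) :
    padicValNat p W.shaOrder ≤ 2 * padicValNat p (AddSubgroup.zmultiples P).index :=
  hX.cha_padicValNat_shaOrder_le hCha hK hH hP hnt (hX.not_dvd_discr_of_isHeegnerPoint hC hK hH hP)
    hD3 hD4 (hX.not_sq_dvd_level_of_isHeegnerPoint hC hP)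

/-- **(d′′) Cha's index certificate ⟹ the Euler half, `hpD`-free** (`p ∣ N` displayed instead).
[cite: Miller2011LMS, Thm. 5.2 and Def. 1.1] [cite: Cha2005, Thm. 21 (p. 173)] -/
theorem _root_.Summit.BirchSwinnertonDyer.Rank1Residual.ClassX11a.missingUpperBoundAt_of_cha_of_index_le'
    (hCha : thm52_padicValNat_shaOrder_le_discr) (hX : ClassX11a W p)
    (hK : IsImaginaryQuadratic K) (hH : SatisfiesHeegnerHypothesis N K)
    {P : (W.baseChange K).toAffine.Point} (hP : IsHeegnerPoint N W K P) (hnt : ¬ IsOfFinAddOrder P)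
    (hD3 : NumberField.discr K ≠ -3) (hD4 : NumberField.discr K ≠ -4)
    (hpN : ¬ p ^ 2 ∣ N) (hpN₁ : p ∣ N)
    {k : ℕ} (hI : padicValNat p (AddSubgroup.zmultiples P).index ≤ k)
    {q : ℚ} (hq : shaAn W = (q : ℂ)) (hv : (2 * k : ℤ) ≤ padicValRat p q) :
    MissingUpperBoundAt W p :=
  hX.missingUpperBoundAt_of_cha_of_index_le hCha hK hH hP hnt (not_dvd_discr_of_dvd_level hK hH hpN₁)
    hD3 hD4 hpN hI hq hv

/-- **(d′′) Cha's index certificate ⟹ the Euler half, granted Carayol, no level clause displayed**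
(`hpD` and `hpN` both discharged): binders = facts `hCha hC` · class `hX` · field `hK hH hD3 hD4` ·
point `hP hnt hI` · `#Ш_an` `hq hv`. The door for the 3Ns/3Nn/5Ns/5S4/7Ns pairs of crux 20406.
[cite: Miller2011LMS, Thm. 5.2 and Def. 1.1] [cite: Cha2005, Thm. 21 (p. 173)] [cite: Carayol1986, Thm. (A)] -/
theorem _root_.Summit.BirchSwinnertonDyer.Rank1Residual.ClassX11a.missingUpperBoundAt_of_cha_of_index_le_of_carayol'
    (hCha : thm52_padicValNat_shaOrder_le_discr)
    (hC : ∀ (M : ℕ) [NeZero M], IsNewformOf.level_eq_conductorNorm (N := M)) (hX : ClassX11a W p)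
    (hK : IsImaginaryQuadratic K) (hH : SatisfiesHeegnerHypothesis N K)
    {P : (W.baseChange K).toAffine.Point} (hP : IsHeegnerPoint N W K P) (hnt : ¬ IsOfFinAddOrder P)
    (hD3 : NumberField.discr K ≠ -3) (hD4 : NumberField.discr K ≠ -4)
    {k : ℕ} (hI : padicValNat p (AddSubgroup.zmultiples P).index ≤ k)
    {q : ℚ} (hq : shaAn W = (q : ℂ)) (hv : (2 * k : ℤ) ≤ padicValRat p q) :
    MissingUpperBoundAt W p :=
  hX.missingUpperBoundAt_of_cha_of_index_le hCha hK hH hP hnt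
    (hX.not_dvd_discr_of_isHeegnerPoint hC hK hH hP) hD3 hD4
    (hX.not_sq_dvd_level_of_isHeegnerPoint hC hP) hI hq hv

/-- **X11a UNIT cell: `BSD(E,p)` from Cha's unit index certificate, `hpD`-free** (`p ∣ N` displayed).
[cite: Miller2011LMS, Thm. 5.2 and Def. 1.1] [cite: Cha2005, Thm. 21 (p. 173) and §5.1] -/
theorem _root_.Summit.BirchSwinnertonDyer.Rank1Residual.ClassX11a.bsdp_of_chaCertificate'
    (hCha : thm52_padicValNat_shaOrder_le_discr) (hGZK : rank_eq_analyticRank_of_analyticRank_le_one)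
    (hX : ClassX11a W p) (hK : IsImaginaryQuadratic K) (hH : SatisfiesHeegnerHypothesis N K)
    {P : (W.baseChange K).toAffine.Point} (hP : IsHeegnerPoint N W K P) (hnt : ¬ IsOfFinAddOrder P)
    (hD3 : NumberField.discr K ≠ -3) (hD4 : NumberField.discr K ≠ -4)
    (hpN : ¬ p ^ 2 ∣ N) (hpN₁ : p ∣ N) (hI : ¬ p ∣ (AddSubgroup.zmultiples P).index)
    {q : ℚ} (hq : shaAn W = (q : ℂ)) (hv : padicValRat p q = 0) : BSDp W p :=
  hX.bsdp_of_chaCertificate hCha hGZK hK hH hP hnt (not_dvd_discr_of_dvd_level hK hH hpN₁) hD3 hD4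
    hpN hI hq hv

/-- **X11a UNIT cell: `BSD(E,p)` from Cha's unit index certificate, granted Carayol, no level clause
displayed** (`hpD`, `hpN` discharged): facts `hCha hGZK hC` · class `hX` · field `hK hH hD3 hD4` ·
point `hP hnt hI` · `#Ш_an` `hq hv`. [cite: Miller2011LMS, Thm. 5.2 and Def. 1.1]
[cite: Cha2005, Thm. 21 (p. 173) and §5.1] [cite: Carayol1986, Thm. (A)] -/
theorem _root_.Summit.BirchSwinnertonDyer.Rank1Residual.ClassX11a.bsdp_of_chaCertificate_of_carayol'
    (hCha : thm52_padicValNat_shaOrder_le_discr) (hGZK : rank_eq_analyticRank_of_analyticRank_le_one)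
    (hC : ∀ (M : ℕ) [NeZero M], IsNewformOf.level_eq_conductorNorm (N := M)) (hX : ClassX11a W p)
    (hK : IsImaginaryQuadratic K) (hH : SatisfiesHeegnerHypothesis N K)
    {P : (W.baseChange K).toAffine.Point} (hP : IsHeegnerPoint N W K P) (hnt : ¬ IsOfFinAddOrder P)
    (hD3 : NumberField.discr K ≠ -3) (hD4 : NumberField.discr K ≠ -4)
    (hI : ¬ p ∣ (AddSubgroup.zmultiples P).index)
    {q : ℚ} (hq : shaAn W = (q : ℂ)) (hv : padicValRat p q = 0) : BSDp W p :=
  hX.bsdp_of_chaCertificate hCha hGZK hK hH hP hnt (hX.not_dvd_discr_of_isHeegnerPoint hC hK hH hP)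
    hD3 hD4 (hX.not_sq_dvd_level_of_isHeegnerPoint hC hP) hI hq hv

/-! ### §3 (f) The Matar–Nekovář 2019 Thm. 6.7 (1) unit door: irreducible image, NO field clause -/

/-- **Matar–Nekovář's unit certificate ⟹ `Ш(E/ℚ)[p] = 0` on X11a**: Matar–Nekovář 2019 Thm. 6.7 (1)
(`hMN`, PUBLISHED: `K` imaginary quadratic with the Heegner hypothesis for `N`, `y_K` a basic Heegner
point of level `N`, `p ≠ 2` with `E[p]` IRREDUCIBLE — no surjectivity, no `p ∤ D_K`, no reduction
or CM hypothesis —, `(K, p) ≠ (ℚ(√−3), 3)` and `y_K ∉ pE(K)`) gives `Ш(E/K)[p^∞] = 0`, hence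
`Ш(E/ℚ)[p] = 0` (tree `Typed.noPTorsion_of_matarNekovar_of_not_dvd_index`, restriction injective on
the `p`-part for odd `p`). Class side: `p` odd and `E[p]` irreducible are the class; the exclusion
`(K,p) ≠ (ℚ(√−3),3)` is `discr_ne_neg_three_of_dvd_level` from the displayed `p ∣ N`; `y_K ∉ pE(K)`
from `y_K` of infinite order with `p ∤ [E(K) : ℤ y_K]`. [cite: MatarNekovar2019, Thm. 6.7 (1) (p. 498) and §6.1 (p. 497)]
[cite: SerreGaloisCohomology1997, I.§2.4 Cor. to Prop. 9] -/
theorem _root_.Summit.BirchSwinnertonDyer.Rank1Residual.ClassX11a.noPTorsion_of_matarNekovar_of_not_dvd_index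
    (hMN : MatarNekovar2019.thm67_sha_primary_trivial_of_irreducible N W K) (hX : ClassX11a W p)
    (hK : IsImaginaryQuadratic K) (hH : SatisfiesHeegnerHypothesis N K)
    {P : (W.baseChange K).toAffine.Point} (hP : IsHeegnerPoint N W K P) (hnt : ¬ IsOfFinAddOrder P)
    (hpN₁ : p ∣ N) (hI : ¬ p ∣ (AddSubgroup.zmultiples P).index) :
    ∀ x : W.sha, (p : ℤ) • x = 0 → x = 0 :=
  Typed.noPTorsion_of_matarNekovar_of_not_dvd_index W p hMN hK hH hP hnt hX.ne_two hX.irr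
    (discr_ne_neg_three_of_dvd_level hK hH hpN₁) hI

/-- **(f) Matar–Nekovář's unit certificate ⟹ the Euler half** on X11a: `Ш(E/ℚ)[p] = 0` (above) and
`#Ш_an = q` `p`-integral (`0 ≤ ord_p q`, displayed) give `Typed.MissingUpperBoundAt W p` (door (a)).
Binders: facts `hMN hGZK` · class `hX` · field `hK hH` · point `hP hnt hI` · level `p ∣ N` · `#Ш_an`
`hq hv` — NO `d_K`-clause. The cleanest printed door for the UNIT non-surjective cells of crux 20406
(lit g2, F5). [cite: MatarNekovar2019, Thm. 6.7 (1) (p. 498)] [cite: Miller2011LMS, Def. 1.1] -/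
theorem _root_.Summit.BirchSwinnertonDyer.Rank1Residual.ClassX11a.missingUpperBoundAt_of_matarNekovar_of_not_dvd_index
    (hMN : MatarNekovar2019.thm67_sha_primary_trivial_of_irreducible N W K)
    (hGZK : rank_eq_analyticRank_of_analyticRank_le_one) (hX : ClassX11a W p)
    (hK : IsImaginaryQuadratic K) (hH : SatisfiesHeegnerHypothesis N K)
    {P : (W.baseChange K).toAffine.Point} (hP : IsHeegnerPoint N W K P) (hnt : ¬ IsOfFinAddOrder P)
    (hpN₁ : p ∣ N) (hI : ¬ p ∣ (AddSubgroup.zmultiples P).index)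
    {q : ℚ} (hq : shaAn W = (q : ℂ)) (hv : 0 ≤ padicValRat p q) : MissingUpperBoundAt W p :=
  hX.missingUpperBoundAt_of_noPTorsion hGZK hq hv
    (hX.noPTorsion_of_matarNekovar_of_not_dvd_index hMN hK hH hP hnt hpN₁ hI)

/-- **(f) The same granted Carayol** (`hC`; `p ∣ N` discharged): field `hK hH` · point `hP hnt hI` ·
`#Ш_an` `hq hv`. [cite: MatarNekovar2019, Thm. 6.7 (1) (p. 498)] [cite: Carayol1986, Thm. (A)]
[cite: Miller2011LMS, Def. 1.1] -/
theorem _root_.Summit.BirchSwinnertonDyer.Rank1Residual.ClassX11a.missingUpperBoundAt_of_matarNekovar_of_not_dvd_index_of_carayol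
    (hMN : MatarNekovar2019.thm67_sha_primary_trivial_of_irreducible N W K)
    (hGZK : rank_eq_analyticRank_of_analyticRank_le_one)
    (hC : ∀ (M : ℕ) [NeZero M], IsNewformOf.level_eq_conductorNorm (N := M)) (hX : ClassX11a W p)
    (hK : IsImaginaryQuadratic K) (hH : SatisfiesHeegnerHypothesis N K)
    {P : (W.baseChange K).toAffine.Point} (hP : IsHeegnerPoint N W K P) (hnt : ¬ IsOfFinAddOrder P)
    (hI : ¬ p ∣ (AddSubgroup.zmultiples P).index)
    {q : ℚ} (hq : shaAn W = (q : ℂ)) (hv : 0 ≤ padicValRat p q) : MissingUpperBoundAt W p :=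
  hX.missingUpperBoundAt_of_matarNekovar_of_not_dvd_index hMN hGZK hK hH hP hnt
    (hX.dvd_level_of_isHeegnerPoint hC hP) hI hq hv

/-- **X11a UNIT cell (`p ∤ #Ш_an`), any image: `BSD(E,p)` from Matar–Nekovář's unit certificate** —
PUBLISHED facts (`hMN` Matar–Nekovář 2019 Thm. 6.7 (1), `hGZK`) plus the finite certificate (`K`
with the Heegner hypothesis, `y_K` of infinite order, `p ∤ [E(K) : ℤ y_K]`, `p ∣ N`,
`ord_p #Ш_an = 0`); no surjectivity, no `d_K`-clause, any reduction at `p`. Twin of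
`ClassX9.bsdp_of_matarNekovarCertificate` / `Typed.bsdp_of_matarNekovar_of_not_dvd_index`. Per pair;
not a class theorem. [cite: MatarNekovar2019, Thm. 6.7 (1) (p. 498) and §6.1 (p. 497)]
[cite: Miller2011LMS, §1 and Def. 1.1] -/
theorem _root_.Summit.BirchSwinnertonDyer.Rank1Residual.ClassX11a.bsdp_of_matarNekovarCertificate
    (hMN : MatarNekovar2019.thm67_sha_primary_trivial_of_irreducible N W K)
    (hGZK : rank_eq_analyticRank_of_analyticRank_le_one) (hX : ClassX11a W p)
    (hK : IsImaginaryQuadratic K) (hH : SatisfiesHeegnerHypothesis N K)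
    {P : (W.baseChange K).toAffine.Point} (hP : IsHeegnerPoint N W K P) (hnt : ¬ IsOfFinAddOrder P)
    (hpN₁ : p ∣ N) (hI : ¬ p ∣ (AddSubgroup.zmultiples P).index)
    {q : ℚ} (hq : shaAn W = (q : ℂ)) (hv : padicValRat p q = 0) : BSDp W p :=
  bsdp_of_shaAn_unit_of_noPTorsion W p hGZK hX.analyticRank_le_one hq hv
    (hX.noPTorsion_of_matarNekovar_of_not_dvd_index hMN hK hH hP hnt hpN₁ hI)

/-- **The same granted Carayol** (`hC`; `p ∣ N` discharged): facts `hMN hGZK hC` · class `hX` ·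
field `hK hH` · point `hP hnt hI` · `#Ш_an` `hq hv`. [cite: MatarNekovar2019, Thm. 6.7 (1) (p. 498)]
[cite: Carayol1986, Thm. (A)] [cite: Miller2011LMS, §1 and Def. 1.1] -/
theorem _root_.Summit.BirchSwinnertonDyer.Rank1Residual.ClassX11a.bsdp_of_matarNekovarCertificate_of_carayol
    (hMN : MatarNekovar2019.thm67_sha_primary_trivial_of_irreducible N W K)
    (hGZK : rank_eq_analyticRank_of_analyticRank_le_one)
    (hC : ∀ (M : ℕ) [NeZero M], IsNewformOf.level_eq_conductorNorm (N := M)) (hX : ClassX11a W p)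
    (hK : IsImaginaryQuadratic K) (hH : SatisfiesHeegnerHypothesis N K)
    {P : (W.baseChange K).toAffine.Point} (hP : IsHeegnerPoint N W K P) (hnt : ¬ IsOfFinAddOrder P)
    (hI : ¬ p ∣ (AddSubgroup.zmultiples P).index)
    {q : ℚ} (hq : shaAn W = (q : ℂ)) (hv : padicValRat p q = 0) : BSDp W p :=
  hX.bsdp_of_matarNekovarCertificate hMN hGZK hK hH hP hnt (hX.dvd_level_of_isHeegnerPoint hC hP)
    hI hq hv

/-- **Both halves from the Matar–Nekovář unit certificate** (`BSD(E,p)` ⇒ `MissingLowerBoundAt ∧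
MissingUpperBoundAt`, `Ш` finite by `hGZK`) — the currencies of BOTH cruxes (19064 and 20406) at a
unit non-surjective pair, from one certificate. [cite: MatarNekovar2019, Thm. 6.7 (1) (p. 498)]
[cite: Miller2011LMS, §1 and Def. 1.1] -/
theorem _root_.Summit.BirchSwinnertonDyer.Rank1Residual.ClassX11a.halves_of_matarNekovarCertificate
    (hMN : MatarNekovar2019.thm67_sha_primary_trivial_of_irreducible N W K)
    (hGZK : rank_eq_analyticRank_of_analyticRank_le_one) (hX : ClassX11a W p)
    (hK : IsImaginaryQuadratic K) (hH : SatisfiesHeegnerHypothesis N K)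
    {P : (W.baseChange K).toAffine.Point} (hP : IsHeegnerPoint N W K P) (hnt : ¬ IsOfFinAddOrder P)
    (hpN₁ : p ∣ N) (hI : ¬ p ∣ (AddSubgroup.zmultiples P).index)
    {q : ℚ} (hq : shaAn W = (q : ℂ)) (hv : padicValRat p q = 0) :
    MissingLowerBoundAt W p ∧ MissingUpperBoundAt W p := by
  haveI : Finite W.sha := hX.finite_sha hGZK
  exact lower_and_upper_of_missingPPartAt W p (missingPPartAt_of_bsdp W p
    (hX.bsdp_of_matarNekovarCertificate hMN hGZK hK hH hP hnt hpN₁ hI hq hv))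

/-! ### §4 Cha's corner `d_K ∈ {−3, −4}` is empty at `p = 3` and at even level
A prime dividing the level splits in `K`: `2` splits iff `d_K ≡ 1 (mod 8)` (excludes `−3`, `−4`);
`3` split excludes `d_K = −3` (ramified) and `−4` (`(−4/3) = −1`); `5` split excludes `−3`
(`(−3/5) = −1`). So on the `p = 3` regime of crux 20406 (3Ns/3Nn; the N7 residue's unit and non-unit
non-surjective cells) Cha's doors display NO field or level clause granted Carayol; at even level feed
`discr_ne_of_two_dvd_level hK hH h2` to §2 (DOSSIER §13.6: the corner is empty on all 16 `p = 5`
Heegner-index candidates this way). -/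

omit [NeZero N] [Fact p.Prime] in
/-- **`2 ∣ N` ⟹ `d_K ∉ {−3, −4}`** under the Heegner hypothesis (`2` splits ⟺ `d_K ≡ 1 (mod 8)`).
[cite: Darmon2004, Hypothesis 3.9 (p. 35)] [cite: Marcus2018, Ch. 3 Thm. 25] -/
theorem discr_ne_of_two_dvd_level (hK : IsImaginaryQuadratic K)
    (hH : SatisfiesHeegnerHypothesis N K) (h2 : 2 ∣ N) :
    NumberField.discr K ≠ -3 ∧ NumberField.discr K ≠ -4 := by
  have h8 := Literature.SatisfiesHeegnerHypothesis.discr_emod_eight hK.1 hH h2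
  constructor <;> intro hD <;> rw [hD] at h8 <;> omega

omit [NeZero N] [Fact p.Prime] in
/-- **`3 ∣ N` ⟹ `d_K ∉ {−3, −4}`** under the Heegner hypothesis: `3` split is unramified
(`d_K ≠ −3`) and not inert (`(−4/3) = −1` excludes `ℚ(i)`). [cite: Darmon2004, Hypothesis 3.9 (p. 35)]
[cite: Marcus2018, Ch. 3 Thm. 25] -/
theorem discr_ne_of_three_dvd_level (hK : IsImaginaryQuadratic K)
    (hH : SatisfiesHeegnerHypothesis N K) (h3 : 3 ∣ N) :
    NumberField.discr K ≠ -3 ∧ NumberField.discr K ≠ -4 := by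
  refine ⟨fun hD => Literature.SatisfiesHeegnerHypothesis.not_dvd_discr hK.1 hH Nat.prime_three h3
    (by rw [hD]; norm_num), fun hD => ?_⟩
  have hj := Literature.SatisfiesHeegnerHypothesis.jacobiSym_discr_eq_one hK.1 hH Nat.prime_three
    h3 (by norm_num)
  rw [hD] at hj
  norm_num at hj

omit [NeZero N] [Fact p.Prime] in
/-- **`5 ∣ N` ⟹ `d_K ≠ −3`** under the Heegner hypothesis (`(−3/5) = −1`: `5` is inert in
`ℚ(√−3)`). (`d_K = −4` is NOT excluded at `5`: `5` splits in `ℚ(i)`.) [cite: Darmon2004, Hypothesis 3.9 (p. 35)]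
[cite: Marcus2018, Ch. 3 Thm. 25] -/
theorem discr_ne_neg_three_of_five_dvd_level (hK : IsImaginaryQuadratic K)
    (hH : SatisfiesHeegnerHypothesis N K) (h5 : 5 ∣ N) : NumberField.discr K ≠ -3 := by
  intro hD
  have hj := Literature.SatisfiesHeegnerHypothesis.jacobiSym_discr_eq_one hK.1 hH
    (by norm_num : Nat.Prime 5) h5 (by norm_num)
  rw [hD] at hj
  norm_num at hj

/-- **Cha's bound at an X11a pair AT `p = 3`, granted Carayol: NO field or level clause** — `3 ∣ N_E`
splits in `K`, so `3 ∤ d_K`, `d_K ∉ {−3, −4}`, and `9 ∤ N_E`; the record displays `K` (`hK hH`) and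
`y_K` (`hP hnt`) only. The `p = 3` regime of crux 20406 (images 3Ns/3Nn).
[cite: Cha2005, Thm. 21 (p. 173) and §5.1] [cite: Carayol1986, Thm. (A)] -/
theorem _root_.Summit.BirchSwinnertonDyer.Rank1Residual.ClassX11a.cha_padicValNat_shaOrder_le_of_carayol_three
    (hCha : thm52_padicValNat_shaOrder_le_discr)
    (hC : ∀ (M : ℕ) [NeZero M], IsNewformOf.level_eq_conductorNorm (N := M)) (hX : ClassX11a W p)
    (hp3 : p = 3) (hK : IsImaginaryQuadratic K) (hH : SatisfiesHeegnerHypothesis N K)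
    {P : (W.baseChange K).toAffine.Point} (hP : IsHeegnerPoint N W K P) (hnt : ¬ IsOfFinAddOrder P) :
    padicValNat p W.shaOrder ≤ 2 * padicValNat p (AddSubgroup.zmultiples P).index := by
  have h3N : 3 ∣ N := hp3 ▸ hX.dvd_level_of_isHeegnerPoint hC hP
  have hD := discr_ne_of_three_dvd_level hK hH h3N
  exact hX.cha_padicValNat_shaOrder_le_of_carayol hCha hC hK hH hP hnt hD.1 hD.2

/-- **Cha's index certificate ⟹ the Euler half AT `p = 3`, granted Carayol, no field or level clause**:
facts `hCha hC` · class `hX`, `p = 3` · field `hK hH` · point `hP hnt hI` · `#Ш_an` `hq hv`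
(`2k ≤ ord_3 q`). The `k`-general door for the N7 residue's NON-unit non-surjective cells.
[cite: Miller2011LMS, Thm. 5.2 and Def. 1.1] [cite: Cha2005, Thm. 21 (p. 173)] [cite: Carayol1986, Thm. (A)] -/
theorem _root_.Summit.BirchSwinnertonDyer.Rank1Residual.ClassX11a.missingUpperBoundAt_of_cha_of_index_le_of_carayol_three
    (hCha : thm52_padicValNat_shaOrder_le_discr)
    (hC : ∀ (M : ℕ) [NeZero M], IsNewformOf.level_eq_conductorNorm (N := M)) (hX : ClassX11a W p)
    (hp3 : p = 3) (hK : IsImaginaryQuadratic K) (hH : SatisfiesHeegnerHypothesis N K)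
    {P : (W.baseChange K).toAffine.Point} (hP : IsHeegnerPoint N W K P) (hnt : ¬ IsOfFinAddOrder P)
    {k : ℕ} (hI : padicValNat p (AddSubgroup.zmultiples P).index ≤ k)
    {q : ℚ} (hq : shaAn W = (q : ℂ)) (hv : (2 * k : ℤ) ≤ padicValRat p q) :
    MissingUpperBoundAt W p := by
  have h3N : 3 ∣ N := hp3 ▸ hX.dvd_level_of_isHeegnerPoint hC hP
  have hD := discr_ne_of_three_dvd_level hK hH h3N
  exact hX.missingUpperBoundAt_of_cha_of_index_le_of_carayol' hCha hC hK hH hP hnt hD.1 hD.2 hI hq hv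

/-- **X11a UNIT cell AT `p = 3`: `BSD(E,3)` from Cha's unit index certificate, granted Carayol, no
field or level clause** (facts `hCha hGZK hC` · class · `hK hH` · `hP hnt hI` · `hq hv`). (The
Matar–Nekovář door `bsdp_of_matarNekovarCertificate_of_carayol` gives the same from `hMN` at any `p`.)
[cite: Miller2011LMS, Thm. 5.2 and Def. 1.1] [cite: Cha2005, Thm. 21 (p. 173) and §5.1]
[cite: Carayol1986, Thm. (A)] -/
theorem _root_.Summit.BirchSwinnertonDyer.Rank1Residual.ClassX11a.bsdp_of_chaCertificate_of_carayol_three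
    (hCha : thm52_padicValNat_shaOrder_le_discr) (hGZK : rank_eq_analyticRank_of_analyticRank_le_one)
    (hC : ∀ (M : ℕ) [NeZero M], IsNewformOf.level_eq_conductorNorm (N := M)) (hX : ClassX11a W p)
    (hp3 : p = 3) (hK : IsImaginaryQuadratic K) (hH : SatisfiesHeegnerHypothesis N K)
    {P : (W.baseChange K).toAffine.Point} (hP : IsHeegnerPoint N W K P) (hnt : ¬ IsOfFinAddOrder P)
    (hI : ¬ p ∣ (AddSubgroup.zmultiples P).index)
    {q : ℚ} (hq : shaAn W = (q : ℂ)) (hv : padicValRat p q = 0) : BSDp W p := by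
  have h3N : 3 ∣ N := hp3 ▸ hX.dvd_level_of_isHeegnerPoint hC hP
  have hD := discr_ne_of_three_dvd_level hK hH h3N
  exact hX.bsdp_of_chaCertificate_of_carayol' hCha hGZK hC hK hH hP hnt hD.1 hD.2 hI hq hv

end Summit.BirchSwinnertonDyer.Rank1Residual.X11a

end
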